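import Literature.GroupTheory.FiniteAbelian.AlternatingPairing
import HarnessLib

/-!
# Assembling a pairing with kernel the divisible elements from alternating pairings at single prime-power levels

Pure algebra, written for the Cassels–Tate pairing (`WeierstrassCurve.exists_casselsTate_pairing`,
Silverman *AEC* Thm. X.4.14 = Milne *ADT* I Thm. 6.13(a) for elliptic curves) but stated in general;
no number theory is imported and **no named fact is introduced** (D-0026).

## Why this file

The tree's first assembly device (`TorsionPairingAssembly.lean`, `TorsionPairingFamily`) glues
pairings `B_m` on the torsion levels `Ш[m]` that are COMPATIBLE under `Ш[m] ⊆ Ш[n]` (`m ∣ n`). The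
Cassels–Tate value at level `m` is `∑_v inv_v(…)` for the local invariant maps
`inv_v : H²(K_v, μ_m) → ℤ/m`, and the tree's Poitou–Tate fact
(`Literature.NumberTheory.GaloisCohomology.poitouTate_sum_localTatePairing_eq_zero`) provides such a
family `inv` SEPARATELY FOR EACH LEVEL, with no compatibility between the levels (any family of unit
multiples has the same properties), so compatibility of the `B_m` cannot be derived from it. This
file removes the need: **an alternating pairing with the Cassels–Tate kernel property at each single
prime-power level suffices**, with no relation between different levels.

## Main result

`exists_pairing_forall_eq_zero_iff_mem_divHull`: let `G` be a torsion abelian group with all `G[n]`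
(`n > 0`) finite, and suppose that for every prime power `q = p^k`, `k > 0`, there is an alternating
bi-additive `B_q : G[q] × G[q] → T` with `(∀ y, B_q(x, y) = 0) ↔ x ∈ qG` (`IsLevelPairing`; for
`G = Ш` this is Milne's fixed-level theorem: Prop. 6.9 + Lemma 6.17 + the final diagram of the proof
of Thm. 6.13(a), and the first case of the definition for `⇐`). Then there is an alternating
bi-additive `B : G × G → T` whose kernel is exactly `G¹ = ⋂ₙ nG` (`divHull G`, the tree's
`AddSubgroup.divisibleElements`).

## Proof

* `exists_nsmul_eq_mem_divHull`: since the fibres of `n•` are finite (translates of `G[n]`), the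
  subgroup `G¹` of infinitely divisible elements is itself divisible (a decreasing sequence of
  non-empty subsets `{y : ny = x, y ∈ j!G}` of a finite set has a common point);
* `exists_retraction_divHull`: a divisible group is an injective `ℤ`-module (Mathlib
  `Module.Baer.of_divisible`), so `G = G¹ ⊕ R` with `R = ker r` for a retraction `r` (`red`,
  `coe_r_add_red`), and `R` has no non-zero infinitely divisible element;
* `exists_pow_nsmul_redPPart_eq_zero`, `finite_redPPart`: the `p`-part `R_p` of `R` is killed by some
  `p^e` (else pigeonhole in the finite `G[p]` produces a non-zero element of `R ∩ G¹`), hence finite;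
* `pComp`: the `p`-component map of a torsion group (Bézout), additive, `x = 0` iff all `pComp x = 0`;
* `AssemblyData.pairing`: `B(x, y) = ∑_p B_{p^{k p}}(φ_p x, φ_p y)` with `φ_p = pComp ∘ red`
  (`p^{k p}` killing `R_p`), a finite sum (`finsum` over the prime factors of the order of `red x`);
  alternating (`pairing_self`); **kernel `= G¹`** (`forall_pairing_eq_zero_iff`): on `R_p` the pairing
  is `B_p(φ_p x, ·)` (`pairing_apply_of_mem_redPPart`), elements of `G¹ ∩ G[q]` pair to zero with
  everything by the kernel property and skew-symmetry (`B_apply_eq_zero_of_mem_divHull`), so `x` in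
  the kernel forces `B_p(φ_p x, G[q]) = 0`, whence `φ_p x ∈ qG`, whence (reducing mod `G¹` and taking
  `p`-components) `φ_p x ∈ q R_p = 0` (`phi_eq_zero`).

## References

* [MilneADT2006] J. S. Milne, *Arithmetic Duality Theorems*, 2nd ed. (2006), I §6, Prop. 6.9,
  Lemma 6.17, Thm. 6.13(a) and its proof (pp. 78–88).
* [SilvermanAEC2009] J. H. Silverman, *The Arithmetic of Elliptic Curves*, 2nd ed., Thm. X.4.14.
* L. Fuchs, *Infinite Abelian Groups* I (1970), §21 (divisible groups are direct summands), §23.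
-/

open scoped AddSubgroup

universe u v

namespace Literature.GroupTheory.FiniteAbelian

variable {G : Type u} [AddCommGroup G]

/-! ## The subgroup of infinitely divisible elements and its divisibility -/

/-- The infinitely divisible elements `G¹ = ⋂ₙ nG` of an abelian group (the first Ulm subgroup;
for the groups of this file it is the maximal divisible subgroup, `divHull_divisible`). The same
subgroup as the tree's `AddSubgroup.divisibleElements` (file `NumberTheory/EllipticCurves/BSDSha`,
not imported into this algebra file; see `mem_divHull_iff`). [folklore] -/
def divHull (G : Type u) [AddCommGroup G] : AddSubgroup G where
  carrier := {x | ∀ n : ℕ, 0 < n → ∃ y : G, n • y = x}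
  zero_mem' := fun n _ => ⟨0, nsmul_zero n⟩
  add_mem' := by
    rintro a b ha hb n hn
    obtain ⟨y, rfl⟩ := ha n hn
    obtain ⟨z, rfl⟩ := hb n hn
    exact ⟨y + z, nsmul_add y z n⟩
  neg_mem' := by
    rintro a ha n hn
    obtain ⟨y, rfl⟩ := ha n hn
    exact ⟨-y, neg_nsmul y n⟩

/-- Membership in `divHull`. [folklore] -/
theorem mem_divHull_iff (x : G) : x ∈ divHull G ↔ ∀ n : ℕ, 0 < n → ∃ y : G, n • y = x :=
  Iff.rfl

/-- The fibre of multiplication by `n` over `x` is a translate of the `n`-torsion, hence finite when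
`G[n]` is finite. [folklore] -/
theorem finite_setOf_nsmul_eq (n : ℕ) (hfin : (AddSubgroup.torsionBy G n : Set G).Finite) (x : G) :
    {y : G | n • y = x}.Finite := by
  by_cases h : ∃ y₀ : G, n • y₀ = x
  · obtain ⟨y₀, rfl⟩ := h
    refine (hfin.image fun t => y₀ + t).subset fun y hy => ?_
    refine ⟨y - y₀, ?_, add_sub_cancel y₀ y⟩
    change y - y₀ ∈ AddSubgroup.torsionBy G n
    rw [AddSubgroup.torsionBy.nsmul_iff, nsmul_sub, hy, sub_self]
  · convert Set.finite_empty
    ext y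
    exact ⟨fun hy => h ⟨y, hy⟩, fun hy => hy.elim⟩

/-- **`G¹` is divisible when all `G[n]` are finite**: if `x` is divisible by every positive integer,
then for each `n > 0` some `n`-th "root" of `x` is again divisible by every positive integer.
Proof: the sets `Y_j = {y : ny = x, y ∈ j!·G}` are non-empty, decreasing, and contained in the
finite fibre `{y : ny = x}`, so they have a common point. [folklore] -/
theorem exists_nsmul_eq_mem_divHull (hfin : ∀ n : ℕ, 0 < n → (AddSubgroup.torsionBy G n : Set G).Finite)
    {x : G} (hx : x ∈ divHull G) {n : ℕ} (hn : 0 < n) :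
    ∃ y ∈ divHull G, n • y = x := by
  -- `Y j = {y : n • y = x ∧ ∃ z, j! • z = y}`
  set F : Set G := {y : G | n • y = x} with hF
  have hFfin : F.Finite := finite_setOf_nsmul_eq n (hfin n hn) x
  let Y : ℕ → Set G := fun j => {y : G | n • y = x ∧ ∃ z : G, (Nat.factorial j) • z = y}
  have hYsub : ∀ j, Y j ⊆ F := fun j y hy => hy.1
  have hYne : ∀ j, (Y j).Nonempty := fun j => by
    obtain ⟨z, hz⟩ := hx (n * Nat.factorial j) (Nat.mul_pos hn (Nat.factorial_pos j))
    refine ⟨Nat.factorial j • z, ?_, z, rfl⟩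
    rw [← mul_nsmul', hz]
  have hYmono : ∀ {i j}, i ≤ j → Y j ⊆ Y i := fun {i j} hij y hy => by
    obtain ⟨hy1, z, hz⟩ := hy
    obtain ⟨k, hk⟩ := Nat.factorial_dvd_factorial hij
    refine ⟨hy1, k • z, ?_⟩
    rw [← mul_nsmul', ← hk, hz]
  -- a point common to all `Y j`: the finite set `F` cannot carry a strictly decreasing chain
  classical
  have key : ∃ y ∈ F, ∀ j, y ∈ Y j := by
    by_contra hcon
    push Not at hcon
    -- for each `y ∈ F` pick `j y` with `y ∉ Y (j y)`; beyond the max of these, `Y j` is empty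
    choose j hj using hcon
    obtain ⟨y, hy⟩ := hYne (hFfin.toFinset.sup fun y => if h : y ∈ F then j y h else 0)
    have hyF : y ∈ F := hYsub _ hy
    have hle : j y hyF ≤ hFfin.toFinset.sup fun y => if h : y ∈ F then j y h else 0 := by
      have := Finset.le_sup (f := fun y => if h : y ∈ F then j y h else 0)
        (hFfin.mem_toFinset.mpr hyF)
      simpa [dif_pos hyF] using this
    exact hj y hyF (hYmono hle hy)
  obtain ⟨y, -, hy⟩ := key
  refine ⟨y, fun m hm => ?_, (hy 0).1⟩
  obtain ⟨-, z, hz⟩ := hy m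
  obtain ⟨k, hk⟩ := Nat.dvd_factorial hm le_rfl
  exact ⟨k • z, by rw [← mul_nsmul', ← hk, hz]⟩

/-- `G¹` as a divisible group (`DivisibleBy (divHull G) ℤ`, data chosen by `exists_nsmul_eq_mem_divHull`),
when all `G[n]` are finite. [folklore] -/
@[reducible]
noncomputable def divisibleByDivHull
    (hfin : ∀ n : ℕ, 0 < n → (AddSubgroup.torsionBy G n : Set G).Finite) :
    DivisibleBy (divHull G) ℤ where
  div x n := if hn : n = 0 then 0 else
    n.sign • ⟨(exists_nsmul_eq_mem_divHull hfin x.2 (Int.natAbs_pos.mpr hn)).choose,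
      (exists_nsmul_eq_mem_divHull hfin x.2 (Int.natAbs_pos.mpr hn)).choose_spec.1⟩
  div_zero x := by simp
  div_cancel {n} x hn := by
    rw [dif_neg hn, smul_comm, ← mul_zsmul, Int.sign_mul_self_eq_natAbs, natCast_zsmul]
    exact Subtype.ext (exists_nsmul_eq_mem_divHull hfin x.2 (Int.natAbs_pos.mpr hn)).choose_spec.2

/-- **`G¹` is a direct summand** when all `G[n]` are finite: there is a retraction `r : G → G¹`
(a divisible group is an injective `ℤ`-module — Mathlib `Module.Baer.of_divisible` — so the
identity of `G¹` extends over `G¹ ↪ G`). [folklore] -/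
theorem exists_retraction_divHull
    (hfin : ∀ n : ℕ, 0 < n → (AddSubgroup.torsionBy G n : Set G).Finite) :
    ∃ r : G →+ divHull G, ∀ x : divHull G, r x = x := by
  letI := divisibleByDivHull hfin
  have hinj : Module.Injective ℤ (divHull G) := (Module.Baer.of_divisible (divHull G)).injective
  obtain ⟨h, hh⟩ := hinj.out ((divHull G).subtype.toIntLinearMap)
    (fun x y hxy => Subtype.ext hxy) LinearMap.id
  exact ⟨h.toAddMonoidHom, fun x => hh x⟩

/-! ## The reduced complement `R = ker r` and its `p`-parts -/

section Reduced

variable (r : G →+ divHull G)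

/-- The projection `x ↦ x - r x` onto the complement `R = ker r` of `G¹`. [folklore] -/
def red (x : G) : G := x - (r x : G)

/-- `red` is additive. [folklore] -/
def redHom : G →+ G where
  toFun := red r
  map_zero' := by simp [red]
  map_add' x y := by
    simp only [red, map_add, AddSubgroup.coe_add]
    abel

/-- Unfolding `redHom`. [folklore] -/
@[simp] theorem redHom_apply (x : G) : redHom r x = red r x := rfl

variable {r} (hr : ∀ x : divHull G, r x = x)
include hr

/-- `r (x - r x) = 0`. [folklore] -/
theorem r_red (x : G) : r (red r x) = 0 := by
  rw [red, map_sub, hr, sub_self]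

omit hr in
/-- `x = r x + red x` with `r (red x) = 0`: the decomposition `G = G¹ ⊕ R`. [folklore] -/
theorem coe_r_add_red (x : G) : (r x : G) + red r x = x := by
  rw [red, add_sub_cancel]

/-- Uniqueness of the decomposition: an element of `G¹` killed by `r` is `0`. [folklore] -/
theorem eq_zero_of_mem_divHull_of_r_eq_zero {x : G} (hx : x ∈ divHull G) (hrx : r x = 0) : x = 0 := by
  have := hr ⟨x, hx⟩
  rw [hrx] at this
  exact congrArg Subtype.val this.symm

omit hr in
/-- `red x = x` for `x ∈ R = ker r`. [folklore] -/
theorem red_eq_self_of_r_eq_zero {x : G} (hrx : r x = 0) : red r x = x := by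
  rw [red, hrx, AddSubgroup.coe_zero, sub_zero]

/-- `red x = 0` for `x ∈ G¹`. [folklore] -/
theorem red_eq_zero_of_mem_divHull {x : G} (hx : x ∈ divHull G) : red r x = 0 := by
  rw [red, hr ⟨x, hx⟩, sub_self]

/-- **`R = ker r` has no non-zero infinitely divisible elements**, even for division inside `G`.
[folklore] -/
theorem eq_zero_of_r_eq_zero_of_forall_exists_nsmul {x : G} (hrx : r x = 0)
    (hdiv : ∀ n : ℕ, 0 < n → ∃ y : G, n • y = x) : x = 0 :=
  eq_zero_of_mem_divHull_of_r_eq_zero hr hdiv hrx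

end Reduced

/-! ## `p`-power torsion: division by integers prime to `p`, infinite height -/

section PPower

variable {p : ℕ}

/-- An element of `p`-power order is divisible, inside the cyclic group it generates, by every
integer prime to `p` (Bézout). [folklore] -/
theorem exists_zsmul_nsmul_eq_of_coprime {w : G} {c : ℕ} (hw : p ^ c • w = 0) {m : ℕ}
    (hm : m.Coprime p) : ∃ a : ℤ, m • (a • w) = w := by
  obtain ⟨a, b, hab⟩ := Nat.isCoprime_iff_coprime.mpr (hm.pow_right c)
  refine ⟨a, ?_⟩
  have h1 : ((a * m + b * (p ^ c : ℕ) : ℤ)) • w = w := by rw [hab, one_zsmul]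
  rw [add_zsmul, mul_zsmul, mul_zsmul, natCast_zsmul, natCast_zsmul, hw, zsmul_zero, add_zero] at h1
  rw [smul_comm]
  exact h1

/-- **Infinite `p`-height by `p`-power-torsion elements forces infinite divisibility**: if for every
`e` one has `s = p^e • w` with `w` of `p`-power order, then `s ∈ G¹`. [folklore] -/
theorem mem_divHull_of_forall_exists_pow_nsmul_eq (hp : p.Prime) {s : G}
    (h : ∀ e : ℕ, ∃ w : G, (∃ c : ℕ, p ^ c • w = 0) ∧ p ^ e • w = s) : s ∈ divHull G := by
  intro n hn
  obtain ⟨t, m, hpm, rfl⟩ := Nat.exists_eq_pow_mul_and_not_dvd hn.ne' p hp.one_lt.ne'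
  obtain ⟨w, ⟨c, hc⟩, hw⟩ := h t
  have hm : m.Coprime p := (Nat.Prime.coprime_iff_not_dvd hp).mpr hpm |>.symm
  obtain ⟨a, ha⟩ := exists_zsmul_nsmul_eq_of_coprime hc hm
  refine ⟨a • w, ?_⟩
  rw [mul_nsmul', ha, hw]

end PPower

/-! ## The `p`-part of the reduced complement is bounded, hence finite -/

section RedPPart

variable (r : G →+ divHull G) (p : ℕ)

/-- The `p`-part `R_p = {x ∈ ker r : pʲ x = 0 for some j}` of the reduced complement. [folklore] -/
def redPPart : AddSubgroup G where
  carrier := {x | r x = 0 ∧ ∃ j : ℕ, p ^ j • x = 0}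
  zero_mem' := ⟨map_zero r, 0, nsmul_zero _⟩
  add_mem' := by
    rintro a b ⟨ha, i, hi⟩ ⟨hb, j, hj⟩
    refine ⟨by rw [map_add, ha, hb, add_zero], i + j, ?_⟩
    rw [nsmul_add, pow_add, mul_comm, mul_nsmul', hi, nsmul_zero, mul_comm, mul_nsmul', hj,
      nsmul_zero, add_zero]
  neg_mem' := by
    rintro a ⟨ha, i, hi⟩
    exact ⟨by rw [map_neg, ha, neg_zero], i, by rw [smul_neg, hi, neg_zero]⟩

/-- Membership in `redPPart`. [folklore] -/
theorem mem_redPPart_iff {x : G} : x ∈ redPPart r p ↔ r x = 0 ∧ ∃ j : ℕ, p ^ j • x = 0 := Iff.rfl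

variable {r p} (hr : ∀ x : divHull G, r x = x) (hp : p.Prime)
  (hfin : ∀ n : ℕ, 0 < n → (AddSubgroup.torsionBy G n : Set G).Finite)
include hr hp hfin

/-- **`R_p` has bounded exponent**: some `p^e` kills it. Otherwise there are `x_e ∈ R_p` of order
`p^{a_e}`, `a_e > e`; the elements `s_e = p^{a_e - 1} x_e ∈ R ∩ G[p] ∖ 0` take a common value `s`
for infinitely many `e` (`G[p]` is finite), which then has infinite `p`-height by `p`-power-torsion
elements, so lies in `G¹ ∩ R = 0` — a contradiction. [folklore] -/
theorem exists_pow_nsmul_redPPart_eq_zero : ∃ e : ℕ, ∀ x ∈ redPPart r p, p ^ e • x = 0 := by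
  classical
  by_contra hcon
  push Not at hcon
  -- for each `e`: an `s ∈ R ∩ G[p]`, `s ≠ 0`, of height `≥ e`
  have step : ∀ e : ℕ, ∃ s : G, s ≠ 0 ∧ p • s = 0 ∧
      ∃ w : G, r w = 0 ∧ (∃ c : ℕ, p ^ c • w = 0) ∧ p ^ e • w = s := fun e => by
    obtain ⟨x, ⟨hrx, hx⟩, hne⟩ := hcon e
    let a := Nat.find hx
    have ha : p ^ a • x = 0 := Nat.find_spec hx
    have hea : e < a := by
      by_contra hle
      push Not at hle
      obtain ⟨k, hk⟩ := Nat.pow_dvd_pow p hle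
      exact hne (by rw [hk, mul_comm, mul_nsmul', ha, nsmul_zero])
    have ha1 : a - 1 + 1 = a := Nat.sub_add_cancel (Nat.one_le_of_lt hea)
    refine ⟨p ^ (a - 1) • x, fun h0 => ?_, ?_, p ^ (a - 1 - e) • x, ?_, ⟨a, ?_⟩, ?_⟩
    · exact Nat.find_min hx (Nat.sub_one_lt_of_lt hea) h0
    · rw [← mul_nsmul', ← pow_succ', ha1, ha]
    · rw [map_nsmul, hrx, nsmul_zero]
    · rw [← mul_nsmul', mul_comm, mul_nsmul', ha, nsmul_zero]
    · rw [← mul_nsmul', ← pow_add, Nat.add_sub_cancel' (Nat.le_sub_one_of_lt hea)]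
  choose s hs0 hsp hsw using step
  -- pigeonhole in the finite set `G[p]`
  haveI : Finite (AddSubgroup.torsionBy G p : Set G) := (hfin p hp.pos).to_subtype
  let f : ℕ → (AddSubgroup.torsionBy G p : Set G) := fun e =>
    ⟨s e, show s e ∈ AddSubgroup.torsionBy G p from AddSubgroup.torsionBy.nsmul_iff.mpr (hsp e)⟩
  obtain ⟨y, hy⟩ := Finite.exists_infinite_fiber f
  have hinf : Set.Infinite (f ⁻¹' {y}) := Set.infinite_coe_iff.mp hy
  obtain ⟨e₀, he₀⟩ := hinf.nonempty
  -- `s e₀` has infinite height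
  have hdiv : s e₀ ∈ divHull G := by
    refine mem_divHull_of_forall_exists_pow_nsmul_eq hp fun e => ?_
    obtain ⟨e', he', hlt⟩ := hinf.exists_gt e
    have hse : s e' = s e₀ := by
      have h1 : f e' = y := he'
      have h2 : f e₀ = y := he₀
      exact congrArg Subtype.val (h1.trans h2.symm)
    obtain ⟨w, -, hwc, hw⟩ := hsw e'
    obtain ⟨k, hk⟩ := Nat.pow_dvd_pow p hlt.le
    refine ⟨(p ^ e' / p ^ e) • w, ?_, ?_⟩
    · obtain ⟨c, hc⟩ := hwc
      exact ⟨c, by rw [← mul_nsmul', mul_comm, mul_nsmul', hc, nsmul_zero]⟩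
    · rw [← mul_nsmul', Nat.mul_div_cancel' (Nat.pow_dvd_pow p hlt.le), hw, hse]
  obtain ⟨w, hrw, -, hw⟩ := hsw e₀
  have hrs : r (s e₀) = 0 := by rw [← hw, map_nsmul, hrw, nsmul_zero]
  exact hs0 e₀ (eq_zero_of_mem_divHull_of_r_eq_zero hr hdiv hrs)

/-- **`R_p` is finite**: it lies in the finite `G[p^e]`. [folklore] -/
theorem finite_redPPart : (redPPart r p : Set G).Finite := by
  obtain ⟨e, he⟩ := exists_pow_nsmul_redPPart_eq_zero hr hp hfin
  exact (hfin (p ^ e) (pow_pos hp.pos e)).subset fun x hx =>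
    AddSubgroup.torsionBy.nsmul_iff.mpr (he x hx)

end RedPPart

/-! ## `p`-components of torsion elements -/

section PComp

variable (p : ℕ)

/-- `y` is **the `p`-component of `x`**: `y` has `p`-power order and `x - y` has order prime to `p`.
[folklore] -/
def IsPComp (x y : G) : Prop :=
  (∃ j : ℕ, p ^ j • y = 0) ∧ ∃ m : ℕ, m.Coprime p ∧ m • (x - y) = 0

variable {p}

/-- An element killed by a power of `p` and by an integer prime to `p` is `0`. [folklore] -/
theorem eq_zero_of_pow_nsmul_of_coprime_nsmul {z : G} {j m : ℕ} (hj : p ^ j • z = 0)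
    (hm : m.Coprime p) (hmz : m • z = 0) : z = 0 := by
  obtain ⟨a, ha⟩ := exists_zsmul_nsmul_eq_of_coprime hj hm
  rw [smul_comm, hmz, zsmul_zero] at ha
  exact ha.symm

/-- **Uniqueness of the `p`-component.** [folklore] -/
theorem IsPComp.unique {x y y' : G} (h : IsPComp p x y) (h' : IsPComp p x y') : y = y' := by
  obtain ⟨⟨j, hj⟩, m, hm, hmx⟩ := h
  obtain ⟨⟨j', hj'⟩, m', hm', hmx'⟩ := h'
  -- `y - y'` is killed by `p^(j+j')` and by `m m'`
  have h1 : p ^ (j + j') • (y - y') = 0 := by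
    rw [nsmul_sub, pow_add, mul_comm, mul_nsmul', hj, nsmul_zero, mul_comm, mul_nsmul', hj',
      nsmul_zero, sub_zero]
  have h2 : (m * m') • (y - y') = 0 := by
    have e : y - y' = (x - y') - (x - y) := by abel
    rw [e, nsmul_sub, mul_nsmul', hmx', nsmul_zero, mul_comm, mul_nsmul', hmx, nsmul_zero, sub_zero]
  exact sub_eq_zero.mp (eq_zero_of_pow_nsmul_of_coprime_nsmul h1 (hm.mul_left hm') h2)

/-- **Existence of the `p`-component of a torsion element**, as an integer multiple of it (Bézout on
the order `n = p^t m`: `x = (b m) x + (a p^t) x`). [folklore] -/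
theorem exists_isPComp_zsmul (hp : p.Prime) {x : G} {n : ℕ} (hn : 0 < n) (hx : n • x = 0) :
    ∃ c : ℤ, IsPComp p x (c • x) := by
  obtain ⟨t, m, hpm, rfl⟩ := Nat.exists_eq_pow_mul_and_not_dvd hn.ne' p hp.one_lt.ne'
  have hm : m.Coprime p := (Nat.Prime.coprime_iff_not_dvd hp).mpr hpm |>.symm
  obtain ⟨a, b, hab⟩ := Nat.isCoprime_iff_coprime.mpr (hm.pow_right t)
  -- `a m + b p^t = 1`; the `p`-component is `(a m) • x`
  refine ⟨a * m, ⟨t, ?_⟩, m, hm, ?_⟩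
  · rw [← natCast_zsmul, ← mul_zsmul, show ((p ^ t : ℕ) : ℤ) * (a * m) = a * ((p ^ t * m : ℕ)) by
      push_cast; ring, mul_zsmul, natCast_zsmul, hx, zsmul_zero]
  · have e : x - (a * m : ℤ) • x = (b * (p ^ t : ℕ) : ℤ) • x := by
      rw [show (b * (p ^ t : ℕ) : ℤ) = 1 - a * m by rw [← hab]; ring, sub_zsmul, one_zsmul,
        sub_eq_add_neg]
    rw [e, ← natCast_zsmul, ← mul_zsmul, show ((m : ℕ) : ℤ) * (b * (p ^ t : ℕ)) =
      b * ((p ^ t * m : ℕ)) by push_cast; ring, mul_zsmul, natCast_zsmul, hx, zsmul_zero]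

variable (hp : p.Prime) (htors : AddMonoid.IsTorsion G)
include hp htors

/-- Existence of `p`-components in a torsion group. [folklore] -/
theorem exists_isPComp (x : G) : ∃ y : G, IsPComp p x y := by
  obtain ⟨c, hc⟩ := exists_isPComp_zsmul hp (htors x).addOrderOf_pos (addOrderOf_nsmul_eq_zero x)
  exact ⟨_, hc⟩

/-- **The `p`-component map** of a torsion abelian group (the projection onto the `p`-primary part
along the `p'`-part). [folklore] -/
noncomputable def pComp (x : G) : G :=
  (exists_isPComp hp htors x).choose

/-- `pComp x` is the `p`-component of `x`. [folklore] -/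
theorem isPComp_pComp (x : G) : IsPComp p x (pComp hp htors x) :=
  (exists_isPComp hp htors x).choose_spec

/-- `pComp x` is an integer multiple of `x`. [folklore] -/
theorem exists_pComp_eq_zsmul (x : G) : ∃ c : ℤ, pComp hp htors x = c • x := by
  obtain ⟨c, hc⟩ := exists_isPComp_zsmul hp (htors x).addOrderOf_pos (addOrderOf_nsmul_eq_zero x)
  exact ⟨c, (isPComp_pComp hp htors x).unique hc⟩

/-- `pComp` is additive (sums of `p`-components are `p`-components). [folklore] -/
theorem pComp_add (x x' : G) : pComp hp htors (x + x') = pComp hp htors x + pComp hp htors x' := by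
  refine (isPComp_pComp hp htors (x + x')).unique ?_
  obtain ⟨⟨j, hj⟩, m, hm, hmx⟩ := isPComp_pComp hp htors x
  obtain ⟨⟨j', hj'⟩, m', hm', hmx'⟩ := isPComp_pComp hp htors x'
  refine ⟨⟨j + j', ?_⟩, m * m', hm.mul_left hm', ?_⟩
  · rw [nsmul_add, pow_add, mul_comm, mul_nsmul', hj, nsmul_zero, mul_comm, mul_nsmul', hj',
      nsmul_zero, add_zero]
  · have e : x + x' - (pComp hp htors x + pComp hp htors x') =
        (x - pComp hp htors x) + (x' - pComp hp htors x') := by abel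
    rw [e, nsmul_add, mul_comm, mul_nsmul', hmx, nsmul_zero, mul_comm, mul_nsmul', hmx',
      nsmul_zero, add_zero]

/-- `pComp` as an additive endomorphism. [folklore] -/
noncomputable def pCompHom : G →+ G :=
  AddMonoidHom.mk' (pComp hp htors) (pComp_add hp htors)

/-- Unfolding `pCompHom`. [folklore] -/
@[simp] theorem pCompHom_apply (x : G) : pCompHom hp htors x = pComp hp htors x := rfl

/-- `pComp x` has `p`-power order. [folklore] -/
theorem exists_pow_nsmul_pComp_eq_zero (x : G) : ∃ j : ℕ, p ^ j • pComp hp htors x = 0 :=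
  (isPComp_pComp hp htors x).1

/-- An element of `p`-power order is its own `p`-component. [folklore] -/
theorem pComp_eq_self_of_pow_nsmul_eq_zero {x : G} {j : ℕ} (hx : p ^ j • x = 0) :
    pComp hp htors x = x :=
  (isPComp_pComp hp htors x).unique ⟨⟨j, hx⟩, 1, Nat.coprime_one_left p, by rw [sub_self, nsmul_zero]⟩

/-- An element of order prime to `p` has zero `p`-component. [folklore] -/
theorem pComp_eq_zero_of_coprime_nsmul_eq_zero {x : G} {m : ℕ} (hm : m.Coprime p) (hx : m • x = 0) :
    pComp hp htors x = 0 :=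
  (isPComp_pComp hp htors x).unique ⟨⟨0, by rw [pow_zero, one_nsmul]⟩, m, hm, by rwa [sub_zero]⟩

/-- The `q`-component of a `p`-power-torsion element vanishes for a prime `q ≠ p`. [folklore] -/
theorem pComp_eq_zero_of_pow_nsmul_eq_zero_of_ne {q : ℕ} (hq : q.Prime) (hqp : q ≠ p) {x : G} {j : ℕ}
    (hx : q ^ j • x = 0) : pComp hp htors x = 0 :=
  pComp_eq_zero_of_coprime_nsmul_eq_zero hp htors
    ((Nat.coprime_primes hq hp).mpr hqp |>.pow_left j) hx

omit hp in
/-- **If all `p`-components of a torsion element vanish, it is `0`** (its order is prime to every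
prime). [folklore] -/
theorem eq_zero_of_forall_pComp_eq_zero {x : G}
    (h : ∀ (p : ℕ) (hp : p.Prime), pComp hp htors x = 0) : x = 0 := by
  -- the order `n` of `x` is `1`: otherwise take a prime `p ∣ n`
  have hn := (htors x).addOrderOf_pos
  by_contra hx
  have hn1 : addOrderOf x ≠ 1 := fun h1 => hx (AddMonoid.addOrderOf_eq_one_iff.mp h1)
  obtain ⟨q, hq, hqn⟩ := Nat.exists_prime_and_dvd hn1
  obtain ⟨⟨j, hj⟩, m, hm, hmx⟩ := isPComp_pComp hq htors x
  rw [h q hq, sub_zero] at hmx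
  -- `ord x ∣ m`, `q ∣ ord x`, but `m` is prime to `q`
  have h1 : q ∣ m := hqn.trans (addOrderOf_dvd_of_nsmul_eq_zero hmx)
  exact hq.one_lt.ne' (Nat.Coprime.eq_one_of_dvd (hm.symm) h1 |>.symm ▸ rfl)

end PComp

/-! ## Level-wise pairings and the assembled pairing -/

section Assembly

variable {T : Type v} [AddCommGroup T]

/-- **A level-`q` pairing with the Cassels–Tate kernel property**: an alternating bi-additive
`B : G[q] × G[q] → T` whose (left) kernel is exactly `G[q] ∩ qG` — the shape of the FIXED-LEVEL
Cassels–Tate theorem (Milne, *ADT*, I §6: Prop. 6.9 gives the alternating pairing on `Ш[m]`,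
Lemma 6.17 with the final diagram of the proof of Thm. 6.13(a) gives "`⟨a, Ш[m]⟩ = 0 ⇒ a ∈ mШ`",
and the first case of the definition gives "`a ∈ mШ ⇒ ⟨a, ·⟩ = 0`"). [cite: MilneADT2006, Ch. I §6, Lemma 6.17 and proof of Thm. 6.13(a)] -/
def IsLevelPairing (q : ℕ) (B : G[q] →+ G[q] →+ T) : Prop :=
  (∀ x, B x x = 0) ∧ ∀ x : G[q], (∀ y, B x y = 0) ↔ ∃ z : G, q • z = (x : G)

/-- **Assembly data**: a retraction onto `G¹`, an exponent function `k` with `p^{k p}` killing the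
`p`-part of the reduced complement, and level pairings at the levels `p^{k p}`. [folklore] -/
structure AssemblyData (G : Type u) (T : Type v) [AddCommGroup G] [AddCommGroup T] where
  /-- a retraction of `G` onto its infinitely divisible part -/
  r : G →+ divHull G
  hr : ∀ x : divHull G, r x = x
  /-- the exponents: the level at the prime `p` is `p ^ k p` -/
  k : ℕ → ℕ
  hk : ∀ p : ℕ, p.Prime → ∀ x ∈ redPPart r p, p ^ k p • x = 0
  /-- the level pairings (only the values at primes matter) -/
  B : (p : ℕ) → G[p ^ k p] →+ G[p ^ k p] →+ T
  hB : ∀ p : ℕ, p.Prime → IsLevelPairing (p ^ k p) (B p)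

namespace AssemblyData

variable (D : AssemblyData G T) (htors : AddMonoid.IsTorsion G)

/-- The `p`-component of the reduced part of `x` lies in `R_p`. [folklore] -/
theorem pComp_red_mem_redPPart {p : ℕ} (hp : p.Prime) (x : G) :
    pComp hp htors (red D.r x) ∈ redPPart D.r p := by
  obtain ⟨c, hc⟩ := exists_pComp_eq_zsmul hp htors (red D.r x)
  refine ⟨?_, exists_pow_nsmul_pComp_eq_zero hp htors _⟩
  rw [hc, map_zsmul, r_red D.hr, zsmul_zero]

/-- The `p`-component of the reduced part of `x` is killed by the level `p ^ k p`. [folklore] -/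
theorem pComp_red_mem_torsionBy {p : ℕ} (hp : p.Prime) (x : G) :
    pComp hp htors (red D.r x) ∈ G[p ^ D.k p] :=
  AddSubgroup.torsionBy.nsmul_iff.mpr (D.hk p hp _ (D.pComp_red_mem_redPPart htors hp x))

/-- **`φ_p : G → G[p^{k p}]`**, `x ↦` the `p`-component of the reduced part of `x`. [folklore] -/
noncomputable def phi {p : ℕ} (hp : p.Prime) : G →+ G[p ^ D.k p] :=
  ((pCompHom hp htors).comp (redHom D.r)).codRestrict _ fun x => D.pComp_red_mem_torsionBy htors hp x

/-- Unfolding `phi` on underlying elements. [folklore] -/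
@[simp] theorem coe_phi_apply {p : ℕ} (hp : p.Prime) (x : G) :
    (D.phi htors hp x : G) = pComp hp htors (red D.r x) := rfl

/-- The `p`-th term `B_p(φ_p x, φ_p y)` of the assembled pairing (zero at non-primes). [folklore] -/
noncomputable def term (x y : G) (p : ℕ) : T :=
  if hp : p.Prime then D.B p (D.phi htors hp x) (D.phi htors hp y) else 0

/-- The term at a prime. [folklore] -/
theorem term_of_prime (x y : G) {p : ℕ} (hp : p.Prime) :
    D.term htors x y p = D.B p (D.phi htors hp x) (D.phi htors hp y) := dif_pos hp

/-- The term at a non-prime is `0`. [folklore] -/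
theorem term_of_not_prime (x y : G) {p : ℕ} (hp : ¬p.Prime) : D.term htors x y p = 0 := dif_neg hp

/-- The terms are additive in the first variable. [folklore] -/
theorem term_add_left (x x' y : G) (p : ℕ) :
    D.term htors (x + x') y p = D.term htors x y p + D.term htors x' y p := by
  by_cases hp : p.Prime
  · simp only [term_of_prime _ _ _ _ hp, map_add, AddMonoidHom.add_apply]
  · simp only [term_of_not_prime _ _ _ _ hp, add_zero]

/-- The terms are additive in the second variable. [folklore] -/
theorem term_add_right (x y y' : G) (p : ℕ) :
    D.term htors x (y + y') p = D.term htors x y p + D.term htors x y' p := by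
  by_cases hp : p.Prime
  · simp only [term_of_prime _ _ _ _ hp, map_add]
  · simp only [term_of_not_prime _ _ _ _ hp, add_zero]

/-- `φ_p x = 0` unless `p` divides the order of the reduced part of `x`. [folklore] -/
theorem phi_eq_zero_of_not_dvd {p : ℕ} (hp : p.Prime) {x : G} (h : ¬p ∣ addOrderOf (red D.r x)) :
    D.phi htors hp x = 0 := by
  apply Subtype.ext
  rw [coe_phi_apply, AddSubgroup.coe_zero]
  exact pComp_eq_zero_of_coprime_nsmul_eq_zero hp htors
    ((Nat.Prime.coprime_iff_not_dvd hp).mpr h).symm (addOrderOf_nsmul_eq_zero _)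

/-- The terms of the assembled pairing are supported on the prime factors of the order of the reduced
part of `x`. [folklore] -/
theorem support_term_subset (x y : G) :
    Function.support (D.term htors x y) ⊆ (addOrderOf (red D.r x)).primeFactors := by
  intro p hp
  rw [Function.mem_support] at hp
  by_cases hpr : p.Prime
  · have hdvd : p ∣ addOrderOf (red D.r x) := by
      by_contra h
      exact hp (by rw [term_of_prime _ _ _ _ hpr, D.phi_eq_zero_of_not_dvd htors hpr h, map_zero,
        AddMonoidHom.zero_apply])
    exact Nat.mem_primeFactors.mpr ⟨hpr, hdvd, (htors _).addOrderOf_pos.ne'⟩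
  · exact (hp (term_of_not_prime _ _ _ _ hpr)).elim

/-- The terms have finite support. [folklore] -/
theorem finite_support_term (x y : G) : (Function.support (D.term htors x y)).Finite :=
  (Finset.finite_toSet _).subset (D.support_term_subset htors x y)

/-- **The assembled pairing** `B(x, y) = ∑_p B_p(φ_p x, φ_p y)`. [folklore] -/
noncomputable def pairing : G →+ G →+ T :=
  AddMonoidHom.mk' (fun x => AddMonoidHom.mk' (fun y => ∑ᶠ p, D.term htors x y p) fun y y' => by
      rw [← finsum_add_distrib (D.finite_support_term htors x y) (D.finite_support_term htors x y')]
      exact finsum_congr fun p => D.term_add_right htors x y y' p)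
    fun x x' => by
      ext y
      change ∑ᶠ p, D.term htors (x + x') y p = ∑ᶠ p, D.term htors x y p + ∑ᶠ p, D.term htors x' y p
      rw [← finsum_add_distrib (D.finite_support_term htors x y) (D.finite_support_term htors x' y)]
      exact finsum_congr fun p => D.term_add_left htors x x' y p

/-- Unfolding the assembled pairing. [folklore] -/
theorem pairing_apply (x y : G) : D.pairing htors x y = ∑ᶠ p, D.term htors x y p := rfl

/-- **The assembled pairing is alternating.** [folklore] -/
theorem pairing_self (x : G) : D.pairing htors x x = 0 := by
  rw [pairing_apply]
  refine finsum_eq_zero_of_forall_eq_zero fun p => ?_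
  by_cases hp : p.Prime
  · rw [term_of_prime _ _ _ _ hp]
    exact (D.hB p hp).1 _
  · exact term_of_not_prime _ _ _ _ hp

/-! ### The kernel of the assembled pairing -/

/-- For `y` of `p`-power order in the reduced complement, `φ_{p'} y = 0` for every prime `p' ≠ p`
and `φ_p y = y`. [folklore] -/
theorem coe_phi_apply_of_mem_redPPart {p : ℕ} (hp : p.Prime) {y : G} (hy : y ∈ redPPart D.r p)
    {p' : ℕ} (hp' : p'.Prime) :
    (D.phi htors hp' y : G) = if p' = p then y else 0 := by
  obtain ⟨hry, j, hj⟩ := hy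
  rw [coe_phi_apply, red_eq_self_of_r_eq_zero hry]
  split_ifs with h
  · subst h
    exact pComp_eq_self_of_pow_nsmul_eq_zero hp' htors hj
  · exact pComp_eq_zero_of_pow_nsmul_eq_zero_of_ne hp' htors hp (Ne.symm h) hj

/-- **On `R_p` the assembled pairing is the level pairing**: `B(x, y) = B_p(φ_p x, y)` for
`y ∈ R_p`. [folklore] -/
theorem pairing_apply_of_mem_redPPart {p : ℕ} (hp : p.Prime) (x : G) {y : G}
    (hy : y ∈ redPPart D.r p) :
    D.pairing htors x y =
      D.B p (D.phi htors hp x) ⟨y, AddSubgroup.torsionBy.nsmul_iff.mpr (D.hk p hp y hy)⟩ := by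
  rw [pairing_apply, finsum_eq_single _ p fun p' hp' => ?_]
  · rw [term_of_prime _ _ _ _ hp]
    congr 1
    exact Subtype.ext ((D.coe_phi_apply_of_mem_redPPart htors hp hy hp).trans (if_pos rfl))
  · by_cases hpr : p'.Prime
    · rw [term_of_prime _ _ _ _ hpr]
      have h0 : D.phi htors hpr y = 0 :=
        Subtype.ext ((D.coe_phi_apply_of_mem_redPPart htors hp hy hpr).trans (if_neg hp'))
      rw [h0, map_zero]
    · exact term_of_not_prime _ _ _ _ hpr

/-- A level pairing vanishes when either argument is infinitely divisible. [folklore] -/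
theorem B_apply_eq_zero_of_mem_divHull {p : ℕ} (hp : p.Prime) (d w : G[p ^ D.k p])
    (hd : (d : G) ∈ divHull G) : D.B p d w = 0 ∧ D.B p w d = 0 := by
  obtain ⟨z, hz⟩ := hd (p ^ D.k p) (pow_pos hp.pos _)
  have h1 : ∀ w, D.B p d w = 0 := ((D.hB p hp).2 d).mpr ⟨z, hz⟩
  exact ⟨h1 w, by rw [eq_neg_of_alternating (D.B p) (D.hB p hp).1 w d, h1 w, neg_zero]⟩

/-- In the decomposition `y = r y + red y` of an element killed by `n`, both parts are killed by `n`.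
[folklore] -/
theorem nsmul_red_eq_zero {n : ℕ} {y : G} (hy : n • y = 0) :
    n • (D.r y : G) = 0 ∧ n • red D.r y = 0 := by
  have hsum : n • (D.r y : G) + n • red D.r y = 0 := by rw [← nsmul_add, coe_r_add_red, hy]
  have hd : n • (D.r y : G) = 0 := by
    refine eq_zero_of_mem_divHull_of_r_eq_zero D.hr ((divHull G).nsmul_mem (D.r y).2 n) ?_
    have e : n • (D.r y : G) = -(n • red D.r y) := eq_neg_of_add_eq_zero_left hsum
    rw [e, map_neg, map_nsmul, r_red D.hr, nsmul_zero, neg_zero]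
  refine ⟨hd, ?_⟩
  rwa [hd, zero_add] at hsum

/-- **If `x` is in the kernel of the assembled pairing, then `B_p(φ_p x, ·) = 0` on all of
`G[p^{k p}]`** (decompose `y' = d + y''` with `d ∈ G¹ ∩ G[q]`, `y'' ∈ R_p`; `d` pairs to zero by the
kernel property of `B_p` and skew-symmetry, `y''` by hypothesis). [folklore] -/
theorem B_phi_apply_eq_zero {x : G} (hx : ∀ y, D.pairing htors x y = 0) {p : ℕ} (hp : p.Prime)
    (y' : G[p ^ D.k p]) : D.B p (D.phi htors hp x) y' = 0 := by
  have hq : p ^ D.k p • (y' : G) = 0 := AddSubgroup.torsionBy.nsmul_iff.mp y'.2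
  obtain ⟨hd, hy''⟩ := D.nsmul_red_eq_zero hq
  have hmem : red D.r y' ∈ redPPart D.r p := ⟨r_red D.hr _, D.k p, hy''⟩
  let d : G[p ^ D.k p] := ⟨(D.r y' : G), AddSubgroup.torsionBy.nsmul_iff.mpr hd⟩
  let y'' : G[p ^ D.k p] := ⟨red D.r y', AddSubgroup.torsionBy.nsmul_iff.mpr hy''⟩
  have hsplit : y' = d + y'' := Subtype.ext (coe_r_add_red (r := D.r) (y' : G)).symm
  rw [hsplit, map_add, (D.B_apply_eq_zero_of_mem_divHull hp d _ (D.r y').2).2, zero_add,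
    ← D.pairing_apply_of_mem_redPPart htors hp x hmem]
  exact hx _

/-- **If `x` is in the kernel of the assembled pairing, then every `φ_p x` vanishes**: by the kernel
property `φ_p x = q z`, and reducing `z` modulo `G¹` and taking `p`-components, `φ_p x = q z_p` with
`z_p ∈ R_p`, which `q = p^{k p}` kills. [folklore] -/
theorem phi_eq_zero {x : G} (hx : ∀ y, D.pairing htors x y = 0) {p : ℕ} (hp : p.Prime) :
    D.phi htors hp x = 0 := by
  obtain ⟨z, hz⟩ := ((D.hB p hp).2 _).mp (D.B_phi_apply_eq_zero htors hx hp)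
  rw [coe_phi_apply] at hz
  apply Subtype.ext
  rw [coe_phi_apply, AddSubgroup.coe_zero]
  set v := pComp hp htors (red D.r x) with hv
  have hvmem : v ∈ redPPart D.r p := D.pComp_red_mem_redPPart htors hp x
  -- `v = q • red z`
  have h1 : v = p ^ D.k p • red D.r z := by
    have e : v - p ^ D.k p • red D.r z = p ^ D.k p • (D.r z : G) := by
      rw [← hz, red, nsmul_sub, sub_sub_cancel]
    have h0 : v - p ^ D.k p • red D.r z = 0 := by
      refine eq_zero_of_mem_divHull_of_r_eq_zero D.hr (e ▸ (divHull G).nsmul_mem (D.r z).2 _) ?_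
      rw [map_sub, hvmem.1, map_nsmul, r_red D.hr, nsmul_zero, sub_zero]
    exact sub_eq_zero.mp h0
  -- take `p`-components
  have h2 : pComp hp htors v = v :=
    pComp_eq_self_of_pow_nsmul_eq_zero hp htors (D.hk p hp v hvmem)
  rw [← h2, h1, ← pCompHom_apply, map_nsmul, pCompHom_apply]
  exact D.hk p hp _ (D.pComp_red_mem_redPPart htors hp z)

/-- **The kernel of the assembled pairing is `G¹`.** [folklore] -/
theorem forall_pairing_eq_zero_iff (x : G) : (∀ y, D.pairing htors x y = 0) ↔ x ∈ divHull G := by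
  constructor
  · intro hx
    have hred : red D.r x = 0 :=
      eq_zero_of_forall_pComp_eq_zero htors fun p hp => by
        have h := congrArg Subtype.val (D.phi_eq_zero htors hx hp)
        exact h
    have hxeq : (D.r x : G) = x := by
      have h := coe_r_add_red (r := D.r) x
      rwa [hred, add_zero] at h
    rw [← hxeq]
    exact (D.r x).2
  · intro hx y
    rw [pairing_apply]
    refine finsum_eq_zero_of_forall_eq_zero fun p => ?_
    by_cases hp : p.Prime
    · have h0 : D.phi htors hp x = 0 := Subtype.ext (by
        rw [coe_phi_apply, red_eq_zero_of_mem_divHull D.hr hx, ← pCompHom_apply, map_zero]; rfl)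
      rw [term_of_prime _ _ _ _ hp, h0, map_zero, AddMonoidHom.zero_apply]
    · exact term_of_not_prime _ _ _ _ hp

end AssemblyData

/-- **Assembly theorem.** Let `G` be a torsion abelian group all of whose torsion levels `G[n]`
(`n > 0`) are finite, and suppose that for every prime power `q = p^k` (`k > 0`) there is an
alternating bi-additive pairing `B_q : G[q] × G[q] → T` whose kernel is `G[q] ∩ qG`
(`IsLevelPairing`). Then there is an alternating bi-additive pairing `B : G × G → T` whose kernel is
exactly the subgroup `G¹` of infinitely divisible elements. (No compatibility BETWEEN the levels is
required: at each prime only the single level `p^{k p}`, `p^{k p - 1}` killing the `p`-part of the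
reduced quotient, is used.) For `G = Ш(E/K)`, `T = ℚ/ℤ` this turns the fixed-level Cassels–Tate
theorem into Silverman, *AEC*, Thm. X.4.14 / Milne, *ADT*, I Thm. 6.13(a).
[cite: MilneADT2006, Ch. I §6, Thm. 6.13(a)] -/
theorem exists_pairing_forall_eq_zero_iff_mem_divHull {T : Type v} [AddCommGroup T]
    (htors : AddMonoid.IsTorsion G)
    (hfin : ∀ n : ℕ, 0 < n → (AddSubgroup.torsionBy G n : Set G).Finite)
    (hB : ∀ p k : ℕ, p.Prime → 0 < k →
      ∃ B : G[p ^ k] →+ G[p ^ k] →+ T, IsLevelPairing (p ^ k) B) :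
    ∃ B : G →+ G →+ T, (∀ x, B x x = 0) ∧ ∀ x, (∀ y, B x y = 0) ↔ x ∈ divHull G := by
  obtain ⟨r, hr⟩ := exists_retraction_divHull hfin
  have he : ∀ p : ℕ, ∃ e : ℕ, p.Prime → ∀ x ∈ redPPart r p, p ^ e • x = 0 := fun p => by
    by_cases hp : p.Prime
    · obtain ⟨e, he⟩ := exists_pow_nsmul_redPPart_eq_zero hr hp hfin
      exact ⟨e, fun _ => he⟩
    · exact ⟨0, fun h => (hp h).elim⟩
  choose e he using he
  have hB' : ∀ p : ℕ, ∃ B : G[p ^ (e p + 1)] →+ G[p ^ (e p + 1)] →+ T,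
      p.Prime → IsLevelPairing (p ^ (e p + 1)) B := fun p => by
    by_cases hp : p.Prime
    · obtain ⟨B, hB⟩ := hB p (e p + 1) hp (Nat.succ_pos _)
      exact ⟨B, fun _ => hB⟩
    · exact ⟨0, fun h => (hp h).elim⟩
  choose B hB'' using hB'
  let D : AssemblyData G T :=
    { r := r
      hr := hr
      k := fun p => e p + 1
      hk := fun p hp x hx => by rw [pow_succ', mul_nsmul', he p hp x hx, nsmul_zero]
      B := B
      hB := hB'' }
  exact ⟨D.pairing htors, D.pairing_self htors, D.forall_pairing_eq_zero_iff htors⟩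

end Assembly

end Literature.GroupTheory.FiniteAbelian
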